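import Literature.NumberTheory.Automorphic.Liu2021.Def411IrreducibleOfLemD1AsPrinted
import Literature.NumberTheory.Automorphic.Liu2021.Def411WeilCarriersSurvivalSplit
import HarnessLib

/-!
# `hirr` from [Liu2021, Lem. D.1 (1)] AS PRINTED with the survival clause discharged modulo (SPH)

Topic `NumberTheory/Automorphic`; namespace `Literature.NumberTheory.Automorphic.Liu2021.Def411WeilCarriers`.  KERNEL
ONLY: theorems, 0 definitions, 0 records, 0 named facts, 0 sorry.

The entry point `Def411WeilCarriers.rho_isIrreducible_of_lemD1AsPrinted` (`Def411IrreducibleOfLemD1AsPrinted`, §5) derives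
the END displays' reading `hirr` — `(rho … hs ι ε χ).IsIrreducible` — from local splittings `𝓢` adapted to the
displayed splitting (`hfac`), [Liu2021, App. D Step 2]'s `μ_v`, the per-place AS-PRINTED cite `hD1 v : LemD1_1AsPrinted …`,
and the SURVIVAL clause `hS` of Def. 4.11's `⊗'` («the class of `1_{𝒪_vⁿ}` in the local `χ_v`-coinvariants is non-zero
for almost all `v`»).  This file replaces `hS` by the single local hypothesis it reduces to:

* `JW_map_transpose` — the line `J_W = (a)`, `a ∈ Fˣ`, is hermitian: `((J_W).map c)ᵀ = J_W`;
* **`survival_of_sph`** — `hS` FOLLOWS from (SPH): at almost every SPLIT place, the `U(J)(𝒪_v)`-spherical vectors of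
  the local Weil representation `𝓢.omegaLoc v` lie in the span of a linearly independent family `b : ℤ → 𝒮(F_vⁿ)` with
  `b 0 = 1_{𝒪_vⁿ}` shifted by the central uniformiser (`𝓢.omegaLoc v (z₀ · 1) (b j) = b (j+1)`) — the non-split places
  being handled unconditionally (`Def411WeilCarriersSurvivalNonsplit`: the centre is compact there) and the split ones
  by the shift criterion (`Def411WeilCarriersSurvivalSplit`, `TwistedCoinvariantsCentralShiftSurvival`);
* **`rho_isIrreducible_of_lemD1AsPrinted_of_sph`** — §5's theorem with `hS ↦ hsph`: the remaining inputs for `hirr`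
  are DATA `𝓢` + `hfac`, Step 2's `μ_v`, the per-place cite `hD1`, and (SPH).

(SPH) is a statement about the local Weil representation at a split unramified place (in the Schrödinger model of the
eigen-Lagrangian of the split centre the `GL_n(𝒪_v)`-invariants are the indicators of the balls `ϖ^m 𝒪_vⁿ`); it holds
for every local splitting and is NOT proved in the tree (it needs that model for the small pair).  HC_CM is not
mentioned here; nothing of [Liu2021] is asserted.

## References
* [Liu2021] Y. Liu, Camb. J. Math. 9 (2021) = arXiv:2102.11518, Def. 4.11 (FJcycle.tex l. 2090–2096), App. D §D.1
  Steps 1∕2∕3 (l. 5217∕5219∕5221), Lem. D.1 (l. 5227; (1) l. 5229; proof l. 5241–5245).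
* [GelbartRogawski1991] S. Gelbart, J. Rogawski, Invent. Math. 105 (1991), §3.1 Prop. 3.1.1 p. 455 L1–3.
-/

set_option autoImplicit false

noncomputable section

open scoped Matrix Kronecker TensorProduct
open NumberField IsDedekindDomain Filter Set
open Literature.NumberTheory Literature.NumberTheory.Automorphic Literature.NumberTheory.Automorphic.UnitaryGroup
open Literature.NumberTheory.GelbartRogawski1991 Literature.NumberTheory.GelbartRogawski1991.UnitaryDualPair
open Literature.NumberTheory.GelbartRogawski1991.UnitaryDualPair.WeilCoinv
open Literature.NumberTheory.Weil1964 Literature.RepresentationTheory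
open Literature.RepresentationTheory.HeisenbergGroup

namespace Literature.NumberTheory.Automorphic.Liu2021.Def411WeilCarriers

section Line

variable (F E : Type) [Field F] [Field E] [Algebra F E] (c : E ≃ₐ[F] E)

/-- **the hermitian line `J_W = (a)`, `a ∈ Fˣ`, is hermitian**: `((J_W).map c)ᵀ = J_W` (`c` fixes `F`, and a `1 × 1`
matrix is its own transpose). [cite: GelbartRogawski1991, §3.1 p. 454] -/
theorem JW_map_transpose (a : Fˣ) : ((JW F E a).map c)ᵀ = JW F E a := by
  ext i j
  obtain rfl : i = 0 := Subsingleton.elim _ _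
  obtain rfl : j = 0 := Subsingleton.elim _ _
  simp only [Matrix.transpose_apply, Matrix.map_apply, JW_apply]
  exact c.commutes _

end Line

variable (F E : Type) [Field F] [NumberField F] [Field E] [NumberField E] [Algebra F E]
variable (c : E ≃ₐ[F] E) (N : ℕ) {n : ℕ} (e : Fin N × Fin 1 ≃ Fin n)
variable (JV : Matrix (Fin N) (Fin N) E) {TV : Matrix (Fin N) (Fin N) F}
variable [Algebra.IsQuadraticExtension F E] {δ : E} (hcδ : c δ = -δ) (hδ : δ ≠ 0) {d : F}
  (hd : δ * δ = algebraMap F E d) (hV : TV.IsSymm) (hVd : IsUnit TV.det) (hJV : JV = TV.map (algebraMap F E))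

section Rho

variable {s : ∀ a : Fˣ, UnitaryGroup.adelicPair F E c N 1 JV (JW F E a) →* adelicMpCont F (Fin n) (adelicGram F e TV (TW F a))}
  (hs : ∀ a : Fˣ, (splittingDatum F E c N 1 e JV (JW F E a) hcδ hδ hd hV (isSymm_TW F a) hVd (isUnit_det_TW F a) hJV
    (JW_eq F E a)).IsCompatible (s a))
variable (ε : Eps F d) (χ : Chi F E c)
variable (𝓢 : LocalSplitting.FinLocalSplittings F E c n hcδ hδ hd (gram F e TV (TW F (lineOf F d ε)))
    (isSymm_gram F e hV (isSymm_TW F (lineOf F d ε)))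
    (reindex_kronecker_eq_gram_map F E e hJV (JW_eq F E (lineOf F d ε))))
variable {G : Type*} [Group G] {ι : G →* UnitaryGroup.finAdelic F E c N JV} (hι : Function.Surjective ι)

/-- **The survival clause `hS` of Def. 4.11's `⊗'` FROM (SPH).**  For the local splittings `𝓢` of
`U(J_V ⊗ (lineOf ε))(F_v)` and the automorphic character `χ`: the class of `1_{𝒪_vⁿ}` in the `χ_v`-coinvariants of
`ω_v ∘ (u ↦ u · 1)` is non-zero off a finite set of places, PROVIDED (SPH) holds at almost every split place (the
non-split places are unconditional: `Def411WeilCarriersSurvivalNonsplit`). [cite: Liu2021, Def. 4.11 (l. 2090–2096)] -/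
theorem survival_of_sph
    (hsph : ∀ᶠ v : HeightOneSpectrum (𝓞 F) in cofinite, ∀ w : UnitaryGroup.PlacesOver E v, c • w.1 ≠ w.1 →
      ∀ z₀ : UnitaryGroup.localPi E c 1 (JW F E (lineOf F d ε)) v,
        (∀ h : UnitaryGroup.localPi E c 1 (JW F E (lineOf F d ε)) v,
          ∃ (k₀ : UnitaryGroup.localPi E c 1 (JW F E (lineOf F d ε)) v) (m : ℤ),
            k₀ ∈ UnitaryGroup.localInt E c 1 (JW F E (lineOf F d ε)) v ∧ h = k₀ * z₀ ^ m) →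
        ∃ b : ℤ → SchwartzBruhat (Fin n → v.adicCompletion F), b 0 = unitVec F (Fin n) v ∧ LinearIndependent ℂ b ∧
          (∀ j : ℤ, 𝓢.omegaLoc v (localCenter E c n (Matrix.reindex e e (JV ⊗ₖ JW F E (lineOf F d ε)))
            (JW F E (lineOf F d ε)) (JW_apply_ne_zero F E _) v z₀) (b j) = b (j + 1)) ∧
          (∀ u : SchwartzBruhat (Fin n → v.adicCompletion F),
            (∀ κ ∈ UnitaryGroup.localInt E c n (Matrix.reindex e e (JV ⊗ₖ JW F E (lineOf F d ε))) v,
              𝓢.omegaLoc v κ u = u) → u ∈ Submodule.span ℂ (Set.range b))) :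
    ∃ S₁ : Finset (HeightOneSpectrum (𝓞 F)), ∀ v ∉ S₁,
      TwistedCoinv.mk (show Representation ℂ (UnitaryGroup.localPi E c 1 (JW F E (lineOf F d ε)) v) _ from
          (𝓢.omegaLoc v).comp (localCenter E c n (Matrix.reindex e e (JV ⊗ₖ JW F E (lineOf F d ε))) (JW F E (lineOf F d ε))
            (JW_apply_ne_zero F E _) v))
        (localCharOfCenter F E c (JW F E (lineOf F d ε)) (JW_apply_ne_zero F E _) χ.1 v) (unitVec F (Fin n) v) ≠ 0 :=
  𝓢.exists_finset_mk_unitVec_ne_zero_of_sph (JW F E (lineOf F d ε)) (JW_apply_ne_zero F E _)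
    (JW_map_transpose F E c (lineOf F d ε)) χ.2.1 hsph

include hι in
/-- **`hirr` from LEMMA D.1 (1) AS PRINTED + (SPH).**  `Def411WeilCarriers.rho_isIrreducible_of_lemD1AsPrinted` (§5 of
`Def411IrreducibleOfLemD1AsPrinted`: no unitarity binder) with its survival clause `hS` DISCHARGED from (SPH)
(`survival_of_sph`).  Inputs: DATA `𝓢` with `hfac` (the displayed `μ`-splitting factors through the local splittings),
[Liu2021, App. D Step 2]'s `μ_v`, the per-place AS-PRINTED cite `hD1 v : LemD1_1AsPrinted (localLemD1Data … χ … v)`,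
`n ≥ 3`, and (SPH) at the split places.  Nothing of [Liu2021] is asserted.
[cite: Liu2021, Def. 4.11 (l. 2090–2096), App. D §D.1 Steps 1∕2∕3 (l. 5217∕5219∕5221), Lemma D.1 (l. 5227; (1) l. 5229); GelbartRogawski1991, §3.1 Prop. 3.1.1 p. 455 L1–3] -/
theorem rho_isIrreducible_of_lemD1AsPrinted_of_sph
    (hfac : (pairSmall₁ F E c N 1 e JV (JW F E (lineOf F d ε)) (s (lineOf F d ε))).comp
        (finPairToAdelic F E c N 1 JV (JW F E (lineOf F d ε))) =
      localRefSection F E c N 1 e JV (JW F E (lineOf F d ε)) hcδ hδ hd hV (isSymm_TW F _) hJV (JW_eq F E _) 𝓢)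
    (hn : 3 ≤ n)
    (μ : ∀ v : HeightOneSpectrum (𝓞 F), (LocalRing E v)ˣ →* ℂˣ) (hμn : ∀ v x, ‖((μ v x : ℂˣ) : ℂ)‖ = 1)
    (hμc : ∀ v, Continuous fun x => ((μ v x : ℂˣ) : ℂ))
    (hμF : ∀ (v : HeightOneSpectrum (𝓞 F)) (t : (v.adicCompletion F)ˣ),
      μ v (Units.map (algebraMap (v.adicCompletion F) (LocalRing E v)).toMonoidHom t) = 1 ↔
        ∃ x : (LocalRing E v)ˣ, (x : LocalRing E v) * conjLocal E c v x =
          algebraMap (v.adicCompletion F) (LocalRing E v) t)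
    (hD1 : ∀ v, LemD1_1AsPrinted
      (localLemD1Data F E c N e JV hcδ hδ hd hV hVd hJV (lineOf F d ε) 𝓢 hn μ hμn hμc hμF χ.1
        (norm_chi_eq_one F E c (Algebra.IsQuadraticExtension.finrank_eq_two F E)
          (UnitaryGroup.algEquiv_ne_one_of_apply_eq_neg F E c hcδ hδ) χ) χ.2.1 v))
    (hsph : ∀ᶠ v : HeightOneSpectrum (𝓞 F) in cofinite, ∀ w : UnitaryGroup.PlacesOver E v, c • w.1 ≠ w.1 →
      ∀ z₀ : UnitaryGroup.localPi E c 1 (JW F E (lineOf F d ε)) v,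
        (∀ h : UnitaryGroup.localPi E c 1 (JW F E (lineOf F d ε)) v,
          ∃ (k₀ : UnitaryGroup.localPi E c 1 (JW F E (lineOf F d ε)) v) (m : ℤ),
            k₀ ∈ UnitaryGroup.localInt E c 1 (JW F E (lineOf F d ε)) v ∧ h = k₀ * z₀ ^ m) →
        ∃ b : ℤ → SchwartzBruhat (Fin n → v.adicCompletion F), b 0 = unitVec F (Fin n) v ∧ LinearIndependent ℂ b ∧
          (∀ j : ℤ, 𝓢.omegaLoc v (localCenter E c n (Matrix.reindex e e (JV ⊗ₖ JW F E (lineOf F d ε)))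
            (JW F E (lineOf F d ε)) (JW_apply_ne_zero F E _) v z₀) (b j) = b (j + 1)) ∧
          (∀ u : SchwartzBruhat (Fin n → v.adicCompletion F),
            (∀ κ ∈ UnitaryGroup.localInt E c n (Matrix.reindex e e (JV ⊗ₖ JW F E (lineOf F d ε))) v,
              𝓢.omegaLoc v κ u = u) → u ∈ Submodule.span ℂ (Set.range b))) :
    (rho F E c N e JV hcδ hδ hd hV hVd hJV hs ι ε χ).IsIrreducible :=
  rho_isIrreducible_of_lemD1AsPrinted F E c N e JV hcδ hδ hd hV hVd hJV hs ε χ 𝓢 hι hfac hn μ hμn hμc hμF hD1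
    (survival_of_sph F E c N e JV hcδ hδ hd hV hJV ε χ 𝓢 hsph)

/-! ### Supplier-friendly `∃ z₀` forms (appended) -/

/-- **`hS` from ONE central shift per split place** (the supplier chooses `z₀`): the survival clause from the `∃ z₀`
form of (SPH) — at almost every split place SOME central `z₀` with `U(J₁)(F_v) = U(J₁)(𝒪_v) · z₀^ℤ` carries spherical
data `b`. [cite: Liu2021, Def. 4.11 (l. 2090–2096)] -/
theorem survival_of_exists_shift
    (hsph : ∀ᶠ v : HeightOneSpectrum (𝓞 F) in cofinite, ∀ w : UnitaryGroup.PlacesOver E v, c • w.1 ≠ w.1 →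
      ∃ z₀ : UnitaryGroup.localPi E c 1 (JW F E (lineOf F d ε)) v,
        (∀ h : UnitaryGroup.localPi E c 1 (JW F E (lineOf F d ε)) v,
          ∃ (k₀ : UnitaryGroup.localPi E c 1 (JW F E (lineOf F d ε)) v) (m : ℤ),
            k₀ ∈ UnitaryGroup.localInt E c 1 (JW F E (lineOf F d ε)) v ∧ h = k₀ * z₀ ^ m) ∧
        ∃ b : ℤ → SchwartzBruhat (Fin n → v.adicCompletion F), b 0 = unitVec F (Fin n) v ∧ LinearIndependent ℂ b ∧
          (∀ j : ℤ, 𝓢.omegaLoc v (localCenter E c n (Matrix.reindex e e (JV ⊗ₖ JW F E (lineOf F d ε)))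
            (JW F E (lineOf F d ε)) (JW_apply_ne_zero F E _) v z₀) (b j) = b (j + 1)) ∧
          (∀ u : SchwartzBruhat (Fin n → v.adicCompletion F),
            (∀ κ ∈ UnitaryGroup.localInt E c n (Matrix.reindex e e (JV ⊗ₖ JW F E (lineOf F d ε))) v,
              𝓢.omegaLoc v κ u = u) → u ∈ Submodule.span ℂ (Set.range b))) :
    ∃ S₁ : Finset (HeightOneSpectrum (𝓞 F)), ∀ v ∉ S₁,
      TwistedCoinv.mk (show Representation ℂ (UnitaryGroup.localPi E c 1 (JW F E (lineOf F d ε)) v) _ from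
          (𝓢.omegaLoc v).comp (localCenter E c n (Matrix.reindex e e (JV ⊗ₖ JW F E (lineOf F d ε))) (JW F E (lineOf F d ε))
            (JW_apply_ne_zero F E _) v))
        (localCharOfCenter F E c (JW F E (lineOf F d ε)) (JW_apply_ne_zero F E _) χ.1 v) (unitVec F (Fin n) v) ≠ 0 :=
  𝓢.exists_finset_mk_unitVec_ne_zero_of_exists_shift (JW F E (lineOf F d ε)) (JW_apply_ne_zero F E _) χ.2.1 hsph

include hι in
/-- **`hirr` from LEMMA D.1 (1) AS PRINTED + the `∃ z₀` form of (SPH)** (`rho_isIrreducible_of_lemD1AsPrinted` of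
`Def411IrreducibleOfLemD1AsPrinted` §5 with `hS ↦ survival_of_exists_shift`).
[cite: Liu2021, Def. 4.11 (l. 2090–2096), App. D §D.1 Steps 1∕2∕3 (l. 5217∕5219∕5221), Lemma D.1 (l. 5227; (1) l. 5229); GelbartRogawski1991, §3.1 Prop. 3.1.1 p. 455 L1–3] -/
theorem rho_isIrreducible_of_lemD1AsPrinted_of_exists_shift
    (hfac : (pairSmall₁ F E c N 1 e JV (JW F E (lineOf F d ε)) (s (lineOf F d ε))).comp
        (finPairToAdelic F E c N 1 JV (JW F E (lineOf F d ε))) =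
      localRefSection F E c N 1 e JV (JW F E (lineOf F d ε)) hcδ hδ hd hV (isSymm_TW F _) hJV (JW_eq F E _) 𝓢)
    (hn : 3 ≤ n)
    (μ : ∀ v : HeightOneSpectrum (𝓞 F), (LocalRing E v)ˣ →* ℂˣ) (hμn : ∀ v x, ‖((μ v x : ℂˣ) : ℂ)‖ = 1)
    (hμc : ∀ v, Continuous fun x => ((μ v x : ℂˣ) : ℂ))
    (hμF : ∀ (v : HeightOneSpectrum (𝓞 F)) (t : (v.adicCompletion F)ˣ),
      μ v (Units.map (algebraMap (v.adicCompletion F) (LocalRing E v)).toMonoidHom t) = 1 ↔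
        ∃ x : (LocalRing E v)ˣ, (x : LocalRing E v) * conjLocal E c v x =
          algebraMap (v.adicCompletion F) (LocalRing E v) t)
    (hD1 : ∀ v, LemD1_1AsPrinted
      (localLemD1Data F E c N e JV hcδ hδ hd hV hVd hJV (lineOf F d ε) 𝓢 hn μ hμn hμc hμF χ.1
        (norm_chi_eq_one F E c (Algebra.IsQuadraticExtension.finrank_eq_two F E)
          (UnitaryGroup.algEquiv_ne_one_of_apply_eq_neg F E c hcδ hδ) χ) χ.2.1 v))
    (hsph : ∀ᶠ v : HeightOneSpectrum (𝓞 F) in cofinite, ∀ w : UnitaryGroup.PlacesOver E v, c • w.1 ≠ w.1 →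
      ∃ z₀ : UnitaryGroup.localPi E c 1 (JW F E (lineOf F d ε)) v,
        (∀ h : UnitaryGroup.localPi E c 1 (JW F E (lineOf F d ε)) v,
          ∃ (k₀ : UnitaryGroup.localPi E c 1 (JW F E (lineOf F d ε)) v) (m : ℤ),
            k₀ ∈ UnitaryGroup.localInt E c 1 (JW F E (lineOf F d ε)) v ∧ h = k₀ * z₀ ^ m) ∧
        ∃ b : ℤ → SchwartzBruhat (Fin n → v.adicCompletion F), b 0 = unitVec F (Fin n) v ∧ LinearIndependent ℂ b ∧
          (∀ j : ℤ, 𝓢.omegaLoc v (localCenter E c n (Matrix.reindex e e (JV ⊗ₖ JW F E (lineOf F d ε)))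
            (JW F E (lineOf F d ε)) (JW_apply_ne_zero F E _) v z₀) (b j) = b (j + 1)) ∧
          (∀ u : SchwartzBruhat (Fin n → v.adicCompletion F),
            (∀ κ ∈ UnitaryGroup.localInt E c n (Matrix.reindex e e (JV ⊗ₖ JW F E (lineOf F d ε))) v,
              𝓢.omegaLoc v κ u = u) → u ∈ Submodule.span ℂ (Set.range b))) :
    (rho F E c N e JV hcδ hδ hd hV hVd hJV hs ι ε χ).IsIrreducible :=
  rho_isIrreducible_of_lemD1AsPrinted F E c N e JV hcδ hδ hd hV hVd hJV hs ε χ 𝓢 hι hfac hn μ hμn hμc hμF hD1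
    (survival_of_exists_shift F E c N e JV hcδ hδ hd hV hJV ε χ 𝓢 hsph)

end Rho

end Literature.NumberTheory.Automorphic.Liu2021.Def411WeilCarriers
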